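import Summits.Parity.GeneralizedHardyLittlewood.Theorems.LiouvilleMADEngineToGHL
import Summits.Parity.GeneralizedHardyLittlewood.Theorems.LiouvilleShiftedTablesPairsHLStatus
import Summits.Parity.GeneralizedHardyLittlewood.Theorems.EngineToPairs.Negative.EngineToPairsShiftBoundary
import Summits.Parity.GeneralizedHardyLittlewood.Theorems.PairsToGHL.Negative.UnboundedSiegelZeros

/-!
# Crux `EngineToGHL` (stmt-Parity-14995), negative lane: what a disproof costs, the shift-zero
# guard of its pair statement, and why prime `k`-tuples would not rescue conjunct 5

Negative lane of the one-piece downstream crux `EngineToGHL` of route LiouvilleMAD (cdisprove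
seat), complementing `LiouvilleMADEngineToGHLIllusory.lean`. By the tree theorem
`Theorems.EngineToGHL.not_engineToGHL_iff` (conjuncts 1–4 are proved, conjunct 5 is
`PairsHL → GeneralizedHardyLittlewood`), `¬EngineToGHL ↔ PairsHL ∧ ¬GHL`. Recorded here, all
kernel-checked and sorry-free:

* §1 THE PRICE OF A DISPROOF. `twinPrimeConjecture_of_not_engineToGHL`,
  `primePairCount_of_not_engineToGHL`, `not_generalizedHardyLittlewood_of_not_engineToGHL`: a
  refutation of the crux is simultaneously a proof of the Hardy–Littlewood prime-pair conjecture in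
  counting form at EVERY even shift (in particular of the twin prime conjecture) and a refutation
  of Green–Tao's Conjecture 1.2. No unconditional kill exists short of both.
* §2 THE GUARD `1 ≤ h` IS LOAD-BEARING (corollaries of the tree theorem
  `EngineToPairs.Negative.not_forall_shift`: the pair statement is false at `h = 0`, where it reads
  `∑_{n ≤ N} Λ(n)² = N + o(N)`). With the guard dropped, conjunct 5 is VACUOUS
  (`conj5_unguarded_vacuous`: its hypothesis proves anything) and conjunct 4 is literally
  `¬(LambdaLiouvilleLevel ∧ ElliottHalberstam)` (`conj4_unguarded_iff`), so the unguarded crux would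
  assert that the route's own engine output contradicts EH (`engineToGHL_unguarded_iff`). Any
  restatement (`EngineToGHL ↦ PairsToGHL`, or a `k`-tuple form over tuples `H`) must keep the guard
  ("no repeated shift").
* §3 PRIME `k`-TUPLES DO NOT RESCUE CONJUNCT 5. Strengthening the hypothesis of conjunct 5 from
  pairs to the full prime `k`-tuples conjecture at fixed tuples
  (`Literature.NumberTheory.Sieve.HardyLittlewoodTuples`, counting form, all admissible `H`) does
  not help in the illusory world: modulo the vendored Matomäki–Merikoski Theorem 1.3,
  `UnboundedSiegelZeros → ¬(HardyLittlewoodTuples → GeneralizedHardyLittlewood)`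
  (`tuplesToGHL_false_of_unboundedSiegelZeros`), and `HardyLittlewoodTuples` itself refutes the crux
  there (`engineToGHL_false_of_unboundedSiegelZeros_of_tuples`). So the obstruction inside
  conjunct 5 is NOT the pairs-versus-tuples gap but the SHIFT-UNIFORMITY `|bᵢ| ≤ L·N` of the typed
  Green–Tao conjecture (Landau–Siegel-hard); contrapositively any proof of
  `HardyLittlewoodTuples → GHL` bounds the quality of Siegel zeros
  (`siegelZeros_bounded_of_tuplesToGHL`).
[folklore]
-/

namespace Summit.Parity.GeneralizedHardyLittlewood.Theorems.EngineToGHL.Negative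

open Finset Filter Asymptotics ArithmeticFunction
open Literature.NumberTheory.Sieve Literature.Barriers.Parity
open Summit.Parity.GeneralizedHardyLittlewood.Theses
open Summit.Parity.GeneralizedHardyLittlewood.Theses.LiouvilleMAD

noncomputable section

/-! ### §1 The price of a disproof -/

/-- Any refutation of `EngineToGHL` contains a proof of binary Hardy–Littlewood at every fixed
shift, hence of the twin prime conjecture. [folklore] -/
theorem twinPrimeConjecture_of_not_engineToGHL (h : ¬ EngineToGHL) : TwinPrimeConjecture :=
  PairsHL.twinPrimeConjecture_of_pairsHL (not_engineToGHL_iff.mp h).1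

/-- … indeed of the Hardy–Littlewood prime-pair conjecture in counting form,
`π_{{0,k}}(x) ∼ 𝔖({0,k}) x / log² x`, at every even shift `k ≥ 2`. [folklore] -/
theorem primePairCount_of_not_engineToGHL (h : ¬ EngineToGHL) {k : ℕ} (hk : Even k)
    (hk1 : 1 ≤ k) :
    (fun x : ℕ ↦ (primeTupleCount ({0, (k : ℤ)} : Finset ℤ) x : ℝ)) ~[atTop]
      fun x : ℕ ↦ singularSeries ({0, (k : ℤ)} : Finset ℤ) * x / Real.log x ^ 2 :=
  (PairsHL.pairsHL_iff_count_even.mp (not_engineToGHL_iff.mp h).1) k hk hk1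

/-- … together with a refutation of Green–Tao's Conjecture 1.2. [folklore] -/
theorem not_generalizedHardyLittlewood_of_not_engineToGHL (h : ¬ EngineToGHL) :
    ¬ _root_.GeneralizedHardyLittlewood :=
  (not_engineToGHL_iff.mp h).2

/-! ### §2 The guard `1 ≤ h` of the pair statement is load-bearing -/

/-- Conjunct 5 of `EngineToGHL` with the UNGUARDED pair hypothesis (`h = 0` admitted) is vacuous:
that hypothesis is false (`EngineToPairs.Negative.not_forall_shift`, the `h = 0` slice reads
`∑_{n ≤ N} Λ(n)² = N + o(N)`), so it proves ANY proposition. [folklore] -/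
theorem conj5_unguarded_vacuous (C : Prop) :
    (∀ h : ℕ, (fun N : ℕ => ∑ n ∈ Finset.Icc 1 N, Λ n * Λ (n + h) -
        singularSeries ({0, (h : ℤ)} : Finset ℤ) * N) =o[atTop] fun N : ℕ => (N : ℝ)) → C :=
  fun H => (EngineToPairs.Negative.not_forall_shift H).elim

/-- Conjunct 4 of `EngineToGHL` with the UNGUARDED conclusion is literally the claim that the
route's engine output `LambdaLiouvilleLevel` is inconsistent with `ElliottHalberstam`. [folklore] -/
theorem conj4_unguarded_iff :
    (LambdaLiouvilleLevel → ElliottHalberstam → ∀ h : ℕ,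
        (fun N : ℕ => ∑ n ∈ Finset.Icc 1 N, Λ n * Λ (n + h) -
          singularSeries ({0, (h : ℤ)} : Finset ℤ) * N) =o[atTop] fun N : ℕ => (N : ℝ)) ↔
      ¬ (LambdaLiouvilleLevel ∧ ElliottHalberstam) :=
  ⟨fun H hLE => EngineToPairs.Negative.not_forall_shift (H hLE.1 hLE.2),
    fun H hL hE => (H ⟨hL, hE⟩).elim⟩

/-- Hence the whole crux with the guard dropped in conjuncts 4 and 5 (conjuncts 1–3 are theorems
and are kept verbatim) is equivalent to `¬(LambdaLiouvilleLevel ∧ ElliottHalberstam)`: the typed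
crux escapes this anti-route reading only through the guard `1 ≤ h`. [folklore] -/
theorem engineToGHL_unguarded_iff :
    ((CosetDecorrelation → FanDecorrelation → DilatedChowla) ∧ (DilatedChowla → TypeIILiouville) ∧
      (TypeIILiouville → LambdaLiouvilleLevel) ∧
      (LambdaLiouvilleLevel → ElliottHalberstam → ∀ h : ℕ,
        (fun N : ℕ => ∑ n ∈ Finset.Icc 1 N, Λ n * Λ (n + h) -
          singularSeries ({0, (h : ℤ)} : Finset ℤ) * N) =o[atTop] fun N : ℕ => (N : ℝ)) ∧
      ((∀ h : ℕ, (fun N : ℕ => ∑ n ∈ Finset.Icc 1 N, Λ n * Λ (n + h) -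
          singularSeries ({0, (h : ℤ)} : Finset ℤ) * N) =o[atTop] fun N : ℕ => (N : ℝ)) →
        _root_.GeneralizedHardyLittlewood)) ↔
      ¬ (LambdaLiouvilleLevel ∧ ElliottHalberstam) := by
  rw [← conj4_unguarded_iff]
  exact ⟨fun H => H.2.2.2.1, fun H => ⟨glue.1, glue.2.1, glue.2.2.1, H,
    conj5_unguarded_vacuous _⟩⟩

/-! ### §3 Prime `k`-tuples at fixed tuples would not rescue conjunct 5 -/

/-- **Even the full prime `k`-tuples conjecture does not imply the typed Green–Tao conjecture in
the illusory world.** Modulo Matomäki–Merikoski's Theorem 1.3: Siegel zeros of unbounded quality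
refute `HardyLittlewoodTuples → GeneralizedHardyLittlewood` (the former gives `PairsHL`, tree
`PairsHL.pairsHL_of_hardyLittlewoodTuples`; the latter fails at the shift-uniform slice
`(n, n + 2q)`, `N = q¹⁰`, tree `PairsToGHL.Negative.not_generalizedHardyLittlewood_of_unboundedSiegelZeros`).
[cite: MatomakiMerikoski2023, Theorem 1.3] -/
theorem tuplesToGHL_false_of_unboundedSiegelZeros (hMM : MatomakiMerikoski2023_pairCorrelation)
    (hU : UnboundedSiegelZeros) (hT : HardyLittlewoodTuples) :
    ¬ (HardyLittlewoodTuples → _root_.GeneralizedHardyLittlewood) := fun H =>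
  PairsToGHL.Negative.not_generalizedHardyLittlewood_of_unboundedSiegelZeros hMM hU (H hT)

/-- In the illusory world the prime `k`-tuples conjecture REFUTES the crux (it supplies `PairsHL`,
and conjunct 5 then asserts the shift-uniform Green–Tao conjecture, which fails there).
[cite: MatomakiMerikoski2023, Theorem 1.3] -/
theorem engineToGHL_false_of_unboundedSiegelZeros_of_tuples
    (hMM : MatomakiMerikoski2023_pairCorrelation) (hU : UnboundedSiegelZeros)
    (hT : HardyLittlewoodTuples) : ¬ EngineToGHL := fun hX =>
  PairsToGHL.Negative.not_generalizedHardyLittlewood_of_unboundedSiegelZeros hMM hU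
    (pairsToGHL_of_engineToGHL hX (PairsHL.pairsHL_of_hardyLittlewoodTuples hT))

/-- Contrapositively: any proof of "prime `k`-tuples at fixed tuples `→` Green–Tao's Conjecture
1.2" is, modulo Matomäki–Merikoski and the `k`-tuples conjecture itself, a Landau–Siegel-type
theorem — there are `η₀`, `q₀` beyond which no primitive quadratic character has a Siegel zero of
quality `η ≥ η₀`. [cite: MatomakiMerikoski2023, Theorem 1.3] -/
theorem siegelZeros_bounded_of_tuplesToGHL (hMM : MatomakiMerikoski2023_pairCorrelation)
    (hT : HardyLittlewoodTuples) (H : HardyLittlewoodTuples → _root_.GeneralizedHardyLittlewood) :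
    ∃ η₀ : ℝ, ∃ q₀ : ℕ, ∀ (q : ℕ) [NeZero q] (χ : DirichletCharacter ℂ q) (η : ℝ),
      q₀ ≤ q → IsSiegelZero χ η → η < η₀ :=
  PairsToGHL.Negative.siegelZeros_bounded_of_pairsToGHL hMM (fun _ => H hT)
    (PairsHL.pairsHL_of_hardyLittlewoodTuples hT)

end

end Summit.Parity.GeneralizedHardyLittlewood.Theorems.EngineToGHL.Negative
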